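import Summits.QuantumAdvantage.QuantumAdvantage.Theorems.WbwObfuscatedGluedTrees.Negative.LoadBearing

/-!
# `WbwObfuscatedGluedTrees` (stmt-QuantumAdvantage-2340) — line `knowledge-of-walk-split`: VOCABULARY

Definitions file (no theorem content beyond unfolding lemmas) for the line `knowledge-of-walk-split` of the
INFORMAL crux `WbwObfuscatedGluedTrees` of route `Summits/QuantumAdvantage/QuantumAdvantage/Theses/WhiteBoxWalk`
(skeleton `Summits/QuantumAdvantage/QuantumAdvantage/Cruxes/WbwObfuscatedGluedTrees/Lines/knowledge-of-walk-split.lean`,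
planner-cruxplan-stmt-QuantumAdvantage-2340-knowledge-of-walk-sp-0; lead prover-line-stmt-QuantumAdvantage-2340-0).
It is §1–§2 of that skeleton, verbatim, so that the three stub files and the final composition import ONE copy of
the vocabulary.  Clause (C) itself (`ClauseC`), `GenType` and `CruxShape` are NOT redeclared: they are the ones of
`Negative/LoadBearing.lean`; the line data, admissibility predicate and the line's target `KnowledgeTransfer`
(§4) stay in the skeleton / composition file under the registered crux namespace
`Summit.QuantumAdvantage.QuantumAdvantage.Cruxes.WbwObfuscatedGluedTrees.KnowledgeOfWalkSplit`.

* §1 walk semantics (`WalkModel`, `endpoint`, `IsValid`, `nameOf`), the adversary's input `inst`, the two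
  generator-specific obligations `KnowledgeOfWalk` (KWA: a deterministic poly-time extractor reading the
  adversary's coins recovers an ENTRANCE-walk to any valid name the adversary outputs) and `WordHard`
  (no PPT outputs an ENTRANCE→answer walk-word), and `Coherent` (the answer is a valid non-entrance name of
  the right length on every seed);
* §2 generator shapes `genObf` (key-indexed circuit family obfuscated by `O`, coins = prefix of the seed
  tail), `genClear` (the circuit in the clear), `keyed` (a key-indexed string read off the seed).

No hardness is asserted anywhere in this file.
-/

set_option linter.dupNamespace false

namespace Summit.QuantumAdvantage.QuantumAdvantage.Theorems.WbwObfuscatedGluedTrees.KnowledgeOfWalk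

open Literature.Computability.Cryptography Literature.Computability.Complexity Filter Asymptotics
open Summit.QuantumAdvantage.QuantumAdvantage.Theorems.WbwObfuscatedGluedTrees.Negative (ClauseC)

/-! ## §1 Walk semantics, the knowledge-of-walk axiom, word hardness -/

/-- Walk semantics of instance strings `x = ⟨code, name of ENTRANCE⟩`: the entrance name, the common length
of vertex names, and the neighbour LISTING computed by the code on a name (`none` = the invalid answer `⊥`;
the listing is in the canonical sorted order of `gluedTreesOracle`, Disproof §1 / typing obligation T4).
[folklore] -/
structure WalkModel where
  /-- name of the ENTRANCE carried by the instance -/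
  entrance : List Bool → List Bool
  /-- the common length of vertex names of the instance -/
  nameLen : List Bool → ℕ
  /-- neighbour listing of the instance on a name (`none` on invalid names) -/
  nbrs : List Bool → List Bool → Option (List (List Bool))

namespace WalkModel

/-- Execute the walk-word `w` (read right to left; each letter = a position in the sorted neighbour list)
from the ENTRANCE of instance `x`; `none` if the walk leaves the valid names. [folklore] -/
def endpoint (M : WalkModel) (x : List Bool) : List ℕ → Option (List Bool)
  | [] => some (M.entrance x)
  | i :: w => (endpoint M x w).bind fun cur => (M.nbrs x cur).bind fun l => l[i]?

/-- `y` is a valid vertex name of instance `x`. [folklore] -/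
def IsValid (M : WalkModel) (x y : List Bool) : Prop := (M.nbrs x y).isSome = true

/-- The NAME PART of an output string `y` for instance `x`: its prefix of length `nameLen x`
(clause (C) asks for `ans s <+: y`; under `Coherent`, `ans s <+: y ↔ nameOf x y = ans s`). [folklore] -/
def nameOf (M : WalkModel) (x y : List Bool) : List Bool := y.take (M.nameLen x)

/-- Unfolding of `endpoint` on the empty word. [folklore] -/
@[simp] theorem endpoint_nil (M : WalkModel) (x : List Bool) : M.endpoint x [] = some (M.entrance x) := rfl

/-- Unfolding of `endpoint` on a nonempty word. [folklore] -/
theorem endpoint_cons (M : WalkModel) (x : List Bool) (i : ℕ) (w : List ℕ) :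
    M.endpoint x (i :: w) = (M.endpoint x w).bind fun cur => (M.nbrs x cur).bind fun l => l[i]? := rfl

end WalkModel

/-- The adversary's input at level `n` and seed `s`: `⟨1ⁿ, gen s⟩` (as in clause (C)). [folklore] -/
def inst (gen : List Bool → List Bool) (n : ℕ) (s : List Bool) : List Bool :=
  boolPair (Computability.unaryEncodeNat n) (gen s)

/-- **KWA — knowledge of walk (classical PPT, white-box; DETERMINISTIC extractor).**  For every PPT `A`
there is a deterministic polynomial-time extractor `E`, reading `A`'s input AND `A`'s coin string, such that
the event "the name part of `A`'s output is a valid vertex name other than the ENTRANCE, yet `E`'s word does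
not end there" has probability (over `A`'s coins, exactly `A.coinLen` of them) decaying superpolynomially on
average over the seed.  White-box analogue of ROOTEDNESS (Childs–Coudron–Gilani arXiv:2211.12447); the
extractor's access to the coins is the non-black-box ingredient Disproof §5 demands (AGGM24 arXiv:2405.15736
§1.4).  NEVER to be asserted for all obfuscators (TRIAGE-r1-3 gadget): it is an axiom about ONE reference
generator. [folklore] -/
def KnowledgeOfWalk (M : WalkModel) (gen : List Bool → List Bool) : Prop :=
  ∀ A : RandAlg (List Bool) (List Bool), IsPPT A id →
    ∃ E : List Bool → List ℕ, PolyTimeComputable id encodingListNatBool.encode E ∧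
      SuperpolynomialDecay atTop (fun n : ℕ => (n : ℝ)) (fun n : ℕ =>
        uniformAvg n fun s => uniformProb (A.coinLen (inst gen n s).length)
          {r | M.IsValid (gen s) (M.nameOf (gen s) (A.run (inst gen n s) r)) ∧
               M.nameOf (gen s) (A.run (inst gen n s) r) ≠ M.entrance (gen s) ∧
               M.endpoint (gen s) (E (boolPair (inst gen n s) r)) ≠
                 some (M.nameOf (gen s) (A.run (inst gen n s) r))})

/-- **WordHard — white-box path-finding hardness (advantage-neutral).**  No PPT, given `⟨1ⁿ, gen s⟩`,
outputs a walk-word from the ENTRANCE whose endpoint is the answer `ans s` (= `name(EXIT)`), except with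
probability decaying superpolynomially on average over the seed.  Weaker than clause (C) whenever the walk
model is efficiently evaluable (evaluate the word); conjecturally true against QUANTUM machines too
(welded-tree path finding, open: CCG22 §4; Li arXiv:2307.12492 / Li–Zur arXiv:2311.07372 treat variants).
[folklore] -/
def WordHard (M : WalkModel) (gen ans : List Bool → List Bool) : Prop :=
  ∀ W : RandAlg (List Bool) (List ℕ), IsPPT W encodingListNatBool.encode →
    SuperpolynomialDecay atTop (fun n : ℕ => (n : ℝ)) (fun n : ℕ =>
      uniformAvg n fun s => W.pr id (inst gen n s) {w | M.endpoint (gen s) w = some (ans s)})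

/-- The walk model is coherent with `(gen, ans)`: on EVERY seed the answer is a valid vertex name of the
right length and is not the ENTRANCE (for the crux's generator: `ans s = name_k(EXIT)`; this is where the
`ans = []` trap of `Negative/TypedTraps.lean` is excluded). [folklore] -/
def Coherent (M : WalkModel) (gen ans : List Bool → List Bool) : Prop :=
  ∀ s, (ans s).length = M.nameLen (gen s) ∧ M.IsValid (gen s) (ans s) ∧ ans s ≠ M.entrance (gen s)

/-! ## §2 Generator shapes: a key-indexed circuit family, obfuscated or in the clear -/

/-- The OBFUSCATED generator built from a key-indexed circuit family `C`: the seed `s ∈ {0,1}ⁿ` is split as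
`k := s.take (h n)` (key material) and the tail `s.drop (h n)`, of which the PREFIX of length
`O.coins (κ n) (C k)` is the obfuscator's coin string; the instance is `⟨code of O(κ n, C k; coins), nm k⟩`.
(Under the discipline `O.coins ≤ n − h n` the law of the code given `k` is exactly `O.obfCodePMF (κ n) (C k)`:
a uniform prefix of a uniform string is uniform.) [folklore] -/
def genObf (O : CircuitObfuscator) (κ h : ℕ → ℕ) (m : List Bool → ℕ)
    (C : (k : List Bool) → Circuit (Fin (m k))) (nm : List Bool → List Bool) (s : List Bool) :
    List Bool :=
  boolPair
    (encodeSizedCircuit ⟨m (s.take (h s.length)),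
      O.obf (κ s.length) (C (s.take (h s.length)))
        ((s.drop (h s.length)).take (O.coins (κ s.length) (C (s.take (h s.length)))))⟩)
    (nm (s.take (h s.length)))

/-- The CLEAR generator: same keys, the circuit `C k` handed out as is (the seed tail is unused).
[folklore] -/
def genClear (h : ℕ → ℕ) (m : List Bool → ℕ) (C : (k : List Bool) → Circuit (Fin (m k)))
    (nm : List Bool → List Bool) (s : List Bool) : List Bool :=
  boolPair (encodeSizedCircuit ⟨m (s.take (h s.length)), C (s.take (h s.length))⟩)
    (nm (s.take (h s.length)))

/-- A key-indexed string (answer / name) read off the seed: `ans (s.take (h |s|))`. [folklore] -/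
def keyed (h : ℕ → ℕ) (ans : List Bool → List Bool) (s : List Bool) : List Bool :=
  ans (s.take (h s.length))

/-- Registered helper stub of crux stmt-QuantumAdvantage-2340 (`ledger workitem stub-add`; the gate admits a
`--supports` file only if it proves a registered stub): the adversary's input unfolds to the input of clause (C).
[folklore] -/
theorem toolkit_vocabulary :
    ∀ (gen : List Bool → List Bool) (n : ℕ) (s : List Bool),
      inst gen n s = boolPair (Computability.unaryEncodeNat n) (gen s) :=
  fun _ _ _ => rfl

end Summit.QuantumAdvantage.QuantumAdvantage.Theorems.WbwObfuscatedGluedTrees.KnowledgeOfWalk
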